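import Summits.AtomisticToContinuum.BoseEinsteinCondensation.Theorems.BECLaplacianL1ModeCountingL1CellFourier
import Literature.MathematicalPhysics.QuantumManyBody.InsertionStateIdentities
import Literature.MathematicalPhysics.QuantumManyBody.PeriodicTorusCalculus
import HarnessLib

/-!
# Route BECLaplacianL1, item `ModeCountingL1` — helper 2/3: the kinetic coherence through slices

Support file for `Summit.AtomisticToContinuum.BoseEinsteinCondensation.Theses.BECLaplacianL1.ModeCountingL1`
(stmt-AtomisticToContinuum-9012), continuing `BECLaplacianL1ModeCountingL1CellFourier.lean`. For a
periodic trial state `Ψ` of `n+1` bosons on the torus of side `L`, the `(i,k)` term of the kinetic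
coherence `∫_{cell^{n+1}} ∂_{i,k}Ψ(X + r eᵢ) conj ∂_{i,k}Ψ(X) dX` is reduced to one-body data:

* `coherenceTerm_eq_slot_zero` — Bose symmetry moves the differentiated particle to the first slot
  (relabelling `X ↦ X ∘ (0 i)` of the cell integral, `fderiv_comp_perm_apply_single`);
* `coherenceTerm_zero_eq_slices` — Fubini `cell^{n+1} = cell^n × cell` with the tagged coordinate
  innermost (`setIntegral_cellN_succ_right_of_continuous`): the first-slot term is
  `∫_{cell^n} A_Y(r) dY` with `A_Y` the autocorrelation of `∂ₖΨ(·, Y)`;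
* `integrable_conj_cellWave_mul_slicePairing` — joint integrability of `(r, Y) ↦ conj(e_p(r)) A_Y(r)`
  (bounded, strongly measurable, finite measure);
* `integral_conj_cellWave_mul_coherenceTerm_zero` — **Fourier coefficients of the first-slot term**:
  `∫_cell conj(e_p) (first-slot term) = L⁶ (2πpₖ/L)² ∫_{cell^n} |ĉ_p(Ψ(·,Y))|² dY` (Fubini on
  `cell × cell^n`, one-body Wiener–Khinchin, derivative rule `ĉ_p(∂ₖf) = (2πi pₖ/L) ĉ_p(f)`).

No new definitions. Concluded in `BECLaplacianL1ModeCountingL1IRBound.lean`.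

## References

* [LSSY2005] E. H. Lieb, R. Seiringer, J. P. Solovej, J. Yngvason, *The Mathematics of the Bose Gas
  and its Condensation*, Birkhäuser 2005, §1.2 (1.17)–(1.19) (one-particle density matrix, mode
  occupations, `tr γ = N`).
* [KLS1988PRL] T. Kennedy, E. H. Lieb, B. S. Shastry, Phys. Rev. Lett. 61 (1988) 2582 (infrared
  bound ⇒ long-range order by mode counting in `d = 3`).
-/

noncomputable section

open MeasureTheory Filter Complex
open scoped ENNReal NNReal ComplexConjugate

namespace Summit.AtomisticToContinuum.BoseEinsteinCondensation.Theorems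

namespace LaplacianModeCounting

open Literature.MathematicalPhysics.QuantumManyBody.BoseGas

variable {N n : ℕ} {L : ℝ}

/-! ## §3 The kinetic coherence through slices at the first particle -/

section ManyBody

variable (Ψ : PeriodicTrialState (n + 1) L)

/-- **Bose symmetry moves the differentiated particle to the first slot**: the `(i,k)` term of the
kinetic coherence equals the `(0,k)` term (relabelling `X ↦ X ∘ (0 i)` of the cell integral, chain
rule for the symmetric `Ψ`). [folklore] -/
theorem coherenceTerm_eq_slot_zero (i : Fin (n + 1)) (k : Fin 3) (r : Space) :
    ∫ X in cellN (n + 1) L, fderiv ℝ Ψ.ψ (X + Pi.single i r)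
        (Pi.single i (EuclideanSpace.single k (1 : ℝ))) *
      conj (fderiv ℝ Ψ.ψ X (Pi.single i (EuclideanSpace.single k (1 : ℝ)))) =
    ∫ X in cellN (n + 1) L, fderiv ℝ Ψ.ψ (X + Pi.single 0 r)
        (Pi.single 0 (EuclideanSpace.single k (1 : ℝ))) *
      conj (fderiv ℝ Ψ.ψ X (Pi.single 0 (EuclideanSpace.single k (1 : ℝ)))) := by
  have hdiff : Differentiable ℝ Ψ.ψ := Ψ.contDiff.differentiable one_ne_zero
  have hsymm : ∀ Y : Config (n + 1), Ψ.ψ (Y ∘ Equiv.swap 0 i) = Ψ.ψ Y := fun Y =>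
    Ψ.symm (Equiv.swap 0 i) Y
  have h1 : ∀ X : Config (n + 1), fderiv ℝ Ψ.ψ X (Pi.single i (EuclideanSpace.single k (1 : ℝ))) =
      fderiv ℝ Ψ.ψ (X ∘ Equiv.swap 0 i) (Pi.single 0 (EuclideanSpace.single k (1 : ℝ))) := by
    intro X
    have h := fderiv_comp_perm_apply_single hdiff (Equiv.swap 0 i) hsymm X 0
      (EuclideanSpace.single k (1 : ℝ))
    rw [Equiv.swap_apply_left] at h
    exact h.symm
  have h2 : ∀ X : Config (n + 1),
      (X + Pi.single i r) ∘ Equiv.swap 0 i = X ∘ Equiv.swap 0 i + Pi.single 0 r := by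
    intro X
    rw [← single_comp_swap i r]
    rfl
  -- the `(i,k)` integrand is the `(0,k)` integrand relabelled
  set F : Config (n + 1) → ℂ := fun Z => fderiv ℝ Ψ.ψ (Z + Pi.single 0 r)
      (Pi.single 0 (EuclideanSpace.single k (1 : ℝ))) *
    conj (fderiv ℝ Ψ.ψ Z (Pi.single 0 (EuclideanSpace.single k (1 : ℝ)))) with hF
  have h3 : ∀ X : Config (n + 1), fderiv ℝ Ψ.ψ (X + Pi.single i r)
        (Pi.single i (EuclideanSpace.single k (1 : ℝ))) *
      conj (fderiv ℝ Ψ.ψ X (Pi.single i (EuclideanSpace.single k (1 : ℝ)))) =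
      F (X ∘ Equiv.swap 0 i) := by
    intro X
    simp only [hF, h1, h2]
  -- relabelling invariance of the cell integral (as `lintegral_cellN_comp_perm`, Bochner form)
  have h4 : ∫ X in cellN (n + 1) L, F (X ∘ Equiv.swap 0 i) = ∫ X in cellN (n + 1) L, F X := by
    set e := (MeasurableEquiv.piCongrLeft (fun _ : Fin (n + 1) => Space) (Equiv.swap 0 i)).symm
      with he
    have hmp : MeasurePreserving e volume volume :=
      (volume_measurePreserving_piCongrLeft (fun _ : Fin (n + 1) => Space) (Equiv.swap 0 i)).symm
    have heX : ∀ (X : Config (n + 1)) (j : Fin (n + 1)), e X j = X (Equiv.swap 0 i j) :=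
      fun X j => rfl
    have hpre : e ⁻¹' cellN (n + 1) L = cellN (n + 1) L := by
      ext X
      simp only [Set.mem_preimage, cellN, Set.mem_setOf_eq, heX]
      exact ⟨fun h j => by simpa using h ((Equiv.swap 0 i).symm j), fun h j => h _⟩
    have key := hmp.setIntegral_preimage_emb e.measurableEmbedding F (cellN (n + 1) L)
    rw [hpre] at key
    exact key
  simp only [hF] at h4
  simp only [h3]
  exact h4

/-- **The first-slot term through slices** (Fubini `cell^{n+1} = cell^n × cell`, tagged coordinate
innermost; `(x, Y) + r e₀ = (x + r, Y)`):
`∫_{cell^{n+1}} ∂_{0,k}Ψ(X + r e₀) conj ∂_{0,k}Ψ(X) dX = ∫_{cell^n} ∫_cell ∂_{0,k}Ψ(x+r, Y) conj ∂_{0,k}Ψ(x, Y) dx dY`.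
[folklore] -/
theorem coherenceTerm_zero_eq_slices (k : Fin 3) (r : Space) :
    ∫ X in cellN (n + 1) L, fderiv ℝ Ψ.ψ (X + Pi.single 0 r)
        (Pi.single 0 (EuclideanSpace.single k (1 : ℝ))) *
      conj (fderiv ℝ Ψ.ψ X (Pi.single 0 (EuclideanSpace.single k (1 : ℝ)))) =
    ∫ Y in cellN n L, ∫ x in cell L, fderiv ℝ Ψ.ψ (Matrix.vecCons (x + r) Y)
        (Pi.single 0 (EuclideanSpace.single k (1 : ℝ))) *
      conj (fderiv ℝ Ψ.ψ (Matrix.vecCons x Y) (Pi.single 0 (EuclideanSpace.single k (1 : ℝ)))) := by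
  have hcont : Continuous fun X : Config (n + 1) => fderiv ℝ Ψ.ψ (X + Pi.single 0 r)
        (Pi.single 0 (EuclideanSpace.single k (1 : ℝ))) *
      conj (fderiv ℝ Ψ.ψ X (Pi.single 0 (EuclideanSpace.single k (1 : ℝ)))) :=
    ((continuous_fderiv_apply_const Ψ.contDiff _).comp (continuous_id.add continuous_const)).mul
      (Complex.continuous_conj.comp (continuous_fderiv_apply_const Ψ.contDiff _))
  rw [setIntegral_cellN_succ_right_of_continuous hcont]
  congr 1
  funext Y
  congr 1
  funext x
  rw [vecCons_add_left]

/-- The first-slot partial derivative `∂_{0,k}Ψ` is bounded (continuous and periodic). [folklore] -/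
theorem exists_norm_dzero_le (hL : 0 < L) (k : Fin 3) :
    ∃ M : ℝ, ∀ X : Config (n + 1),
      ‖fderiv ℝ Ψ.ψ X (Pi.single 0 (EuclideanSpace.single k (1 : ℝ)))‖ ≤ M :=
  exists_norm_le_of_periodic hL (continuous_fderiv_apply_const Ψ.contDiff _)
    (fun X i c => fderiv_apply_periodic Ψ.periodic _ X i c)

/-- The slices `y ↦ Ψ(y, Y)` are `C¹`. [folklore] -/
theorem contDiff_sliceZero (Y : Config n) : ContDiff ℝ 1 fun y => Ψ.ψ (Matrix.vecCons y Y) := by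
  have hupd : ∀ x, Function.update (Matrix.vecCons (0 : Space) Y) 0 x = Matrix.vecCons x Y :=
    fun x => Fin.update_cons_zero (α := fun _ => Space) 0 Y x
  simpa only [hupd] using Ψ.contDiff_slice (Matrix.vecCons 0 Y) 0

/-- **Joint integrability of the slice pairing against a plane wave** on `cell × cell^n`:
`(r, Y) ↦ conj(e_p(r)) ∫_cell ∂_{0,k}Ψ(x + r, Y) conj ∂_{0,k}Ψ(x, Y) dx` is integrable (bounded and
strongly measurable on a finite measure space). [folklore] -/
theorem integrable_conj_cellWave_mul_slicePairing (hL : 0 < L) (k : Fin 3) (p : Fin 3 → ℤ) :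
    Integrable (Function.uncurry fun (r : Space) (Y : Config n) => conj (cellWave L p r) *
      ∫ x in cell L, fderiv ℝ Ψ.ψ (Matrix.vecCons (x + r) Y)
          (Pi.single 0 (EuclideanSpace.single k (1 : ℝ))) *
        conj (fderiv ℝ Ψ.ψ (Matrix.vecCons x Y) (Pi.single 0 (EuclideanSpace.single k (1 : ℝ)))))
      ((volume.restrict (cell L)).prod (volume.restrict (cellN n L))) := by
  haveI : IsFiniteMeasure ((volume : Measure Space).restrict (cell L)) :=
    isFiniteMeasure_restrict.2 (by rw [volume_cell]; exact ENNReal.pow_ne_top ENNReal.ofReal_ne_top)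
  haveI : IsFiniteMeasure ((volume : Measure (Config n)).restrict (cellN n L)) :=
    isFiniteMeasure_restrict.2 (by
      rw [volume_cellN]; exact ENNReal.pow_ne_top (ENNReal.pow_ne_top ENNReal.ofReal_ne_top))
  obtain ⟨M, hM⟩ := exists_norm_dzero_le Ψ hL k
  have hM0 : 0 ≤ M := (norm_nonneg _).trans (hM 0)
  have hd : Continuous fun X : Config (n + 1) =>
      fderiv ℝ Ψ.ψ X (Pi.single 0 (EuclideanSpace.single k (1 : ℝ))) :=
    continuous_fderiv_apply_const Ψ.contDiff _
  -- strong measurability of the parametric integral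
  have hsm : StronglyMeasurable fun q : Space × Config n => ∫ x in cell L,
      fderiv ℝ Ψ.ψ (Matrix.vecCons (x + q.1) q.2) (Pi.single 0 (EuclideanSpace.single k (1 : ℝ))) *
        conj (fderiv ℝ Ψ.ψ (Matrix.vecCons x q.2)
          (Pi.single 0 (EuclideanSpace.single k (1 : ℝ)))) := by
    refine StronglyMeasurable.integral_prod_right' (ν := volume.restrict (cell L))
      (f := fun z : (Space × Config n) × Space =>
        fderiv ℝ Ψ.ψ (Matrix.vecCons (z.2 + z.1.1) z.1.2)
            (Pi.single 0 (EuclideanSpace.single k (1 : ℝ))) *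
          conj (fderiv ℝ Ψ.ψ (Matrix.vecCons z.2 z.1.2)
            (Pi.single 0 (EuclideanSpace.single k (1 : ℝ))))) ?_
    refine Continuous.stronglyMeasurable ?_
    exact (hd.comp ((continuous_snd.add (continuous_fst.comp continuous_fst)).matrixVecCons
      (continuous_snd.comp continuous_fst))).mul
      (Complex.continuous_conj.comp (hd.comp (continuous_snd.matrixVecCons
        (continuous_snd.comp continuous_fst))))
  refine Integrable.of_bound ?_ (M * M * (volume (cell L)).toReal) (Eventually.of_forall ?_)
  · exact ((Complex.continuous_conj.comp ((contDiff_cellWave L p).continuous.comp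
      continuous_fst)).aestronglyMeasurable).mul hsm.aestronglyMeasurable
  · rintro ⟨r, Y⟩
    simp only [Function.uncurry_apply_pair, norm_mul, Complex.norm_conj, norm_cellWave, one_mul]
    have hvol : volume (cell L) < ⊤ := by
      rw [volume_cell]; exact ENNReal.pow_lt_top ENNReal.ofReal_lt_top
    have h := norm_setIntegral_le_of_norm_le_const hvol (C := M * M)
      (f := fun x => fderiv ℝ Ψ.ψ (Matrix.vecCons (x + r) Y)
          (Pi.single 0 (EuclideanSpace.single k (1 : ℝ))) *
        conj (fderiv ℝ Ψ.ψ (Matrix.vecCons x Y) (Pi.single 0 (EuclideanSpace.single k (1 : ℝ)))))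
      (fun x _ => by
        rw [norm_mul, Complex.norm_conj]
        exact mul_le_mul (hM _) (hM _) (norm_nonneg _) hM0)
    rwa [measureReal_def] at h

/-- **Fourier coefficients of the first-slot term.** With `Ψ_Y = Ψ(·, Y)`,
`∫_cell conj(e_p(r)) ∫_{cell^{n+1}} ∂_{0,k}Ψ(X + r e₀) conj ∂_{0,k}Ψ(X) dX dr
  = L⁶ (2πpₖ/L)² ∫_{cell^n} |ĉ_p(Ψ_Y)|² dY`
(slices, Fubini on `cell × cell^n`, one-body Wiener–Khinchin for `∂ₖΨ_Y`, derivative rule).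
[folklore] -/
theorem integral_conj_cellWave_mul_coherenceTerm_zero (hL : 0 < L) (k : Fin 3) (p : Fin 3 → ℤ) :
    ∫ r in cell L, conj (cellWave L p r) *
      ∫ X in cellN (n + 1) L, fderiv ℝ Ψ.ψ (X + Pi.single 0 r)
          (Pi.single 0 (EuclideanSpace.single k (1 : ℝ))) *
        conj (fderiv ℝ Ψ.ψ X (Pi.single 0 (EuclideanSpace.single k (1 : ℝ)))) =
    (((L ^ 3) ^ 2 * (4 * Real.pi ^ 2 * (p k : ℝ) ^ 2 / L ^ 2) *
        ∫ Y in cellN n L, ‖cellFourierCoeff L (fun y => Ψ.ψ (Matrix.vecCons y Y)) p‖ ^ 2 : ℝ) :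
      ℂ) := by
  have hdiff : Differentiable ℝ Ψ.ψ := Ψ.contDiff.differentiable one_ne_zero
  have hInt := integrable_conj_cellWave_mul_slicePairing Ψ hL k p
  -- the one-body functions `h_Y = ∂ₖ Ψ_Y`
  have hh : ∀ Y : Config n, Continuous fun z =>
      fderiv ℝ (fun y => Ψ.ψ (Matrix.vecCons y Y)) z (EuclideanSpace.single k (1 : ℝ)) := fun Y =>
    ((contDiff_sliceZero Ψ Y).continuous_fderiv one_ne_zero).clm_apply continuous_const
  have hhper : ∀ (Y : Config n) (z : Space) (c : Fin 3),
      fderiv ℝ (fun y => Ψ.ψ (Matrix.vecCons y Y)) (z + EuclideanSpace.single c L)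
          (EuclideanSpace.single k (1 : ℝ)) =
        fderiv ℝ (fun y => Ψ.ψ (Matrix.vecCons y Y)) z (EuclideanSpace.single k (1 : ℝ)) := by
    intro Y z c
    rw [fderiv_vecCons_apply hdiff, fderiv_vecCons_apply hdiff, vecCons_add_left,
      fderiv_apply_periodic Ψ.periodic]
  -- the inner integral, for each `Y`
  have hinner : ∀ Y : Config n, ∫ r in cell L, conj (cellWave L p r) *
      ∫ x in cell L, fderiv ℝ Ψ.ψ (Matrix.vecCons (x + r) Y)
          (Pi.single 0 (EuclideanSpace.single k (1 : ℝ))) *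
        conj (fderiv ℝ Ψ.ψ (Matrix.vecCons x Y) (Pi.single 0 (EuclideanSpace.single k (1 : ℝ)))) =
      (((L ^ 3) ^ 2 * (4 * Real.pi ^ 2 * (p k : ℝ) ^ 2 / L ^ 2) *
        ‖cellFourierCoeff L (fun y => Ψ.ψ (Matrix.vecCons y Y)) p‖ ^ 2 : ℝ) : ℂ) := by
    intro Y
    have hn : ‖(2 * Real.pi * Complex.I * (p k) / L : ℂ)‖ ^ 2 =
        4 * Real.pi ^ 2 * (p k : ℝ) ^ 2 / L ^ 2 := by
      rw [show (2 * Real.pi * Complex.I * (p k) / L : ℂ) =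
          ((2 * Real.pi * (p k : ℝ) / L : ℝ) : ℂ) * Complex.I by push_cast; ring,
        norm_mul, Complex.norm_I, mul_one, Complex.norm_real, Real.norm_eq_abs, sq_abs]
      ring
    simp only [← fderiv_vecCons_apply hdiff Y]
    rw [integral_conj_cellWave_mul_autocorr hL (hh Y) (hhper Y) p,
      cellFourierCoeff_fderiv hL (contDiff_sliceZero Ψ Y) (fun x c => Ψ.vecCons_add_axis_left x Y c) k p, norm_mul,
      mul_pow, hn]
    push_cast
    ring
  calc ∫ r in cell L, conj (cellWave L p r) *
        ∫ X in cellN (n + 1) L, fderiv ℝ Ψ.ψ (X + Pi.single 0 r)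
            (Pi.single 0 (EuclideanSpace.single k (1 : ℝ))) *
          conj (fderiv ℝ Ψ.ψ X (Pi.single 0 (EuclideanSpace.single k (1 : ℝ))))
      = ∫ r in cell L, ∫ Y in cellN n L, conj (cellWave L p r) *
          ∫ x in cell L, fderiv ℝ Ψ.ψ (Matrix.vecCons (x + r) Y)
              (Pi.single 0 (EuclideanSpace.single k (1 : ℝ))) *
            conj (fderiv ℝ Ψ.ψ (Matrix.vecCons x Y)
              (Pi.single 0 (EuclideanSpace.single k (1 : ℝ)))) := by
        congr 1
        funext r
        rw [coherenceTerm_zero_eq_slices Ψ k r, integral_const_mul]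
    _ = ∫ Y in cellN n L, ∫ r in cell L, conj (cellWave L p r) *
          ∫ x in cell L, fderiv ℝ Ψ.ψ (Matrix.vecCons (x + r) Y)
              (Pi.single 0 (EuclideanSpace.single k (1 : ℝ))) *
            conj (fderiv ℝ Ψ.ψ (Matrix.vecCons x Y)
              (Pi.single 0 (EuclideanSpace.single k (1 : ℝ)))) :=
        integral_integral_swap hInt
    _ = ∫ Y in cellN n L, (((L ^ 3) ^ 2 * (4 * Real.pi ^ 2 * (p k : ℝ) ^ 2 / L ^ 2) *
          ‖cellFourierCoeff L (fun y => Ψ.ψ (Matrix.vecCons y Y)) p‖ ^ 2 : ℝ) : ℂ) := by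
        congr 1
        funext Y
        exact hinner Y
    _ = _ := by
        rw [integral_complex_ofReal, ← integral_const_mul]

end ManyBody


end LaplacianModeCounting

end Summit.AtomisticToContinuum.BoseEinsteinCondensation.Theorems

end
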